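import Literature.NumberTheory.EllipticCurves.Sprung2012.SharpFlatSelmerDualInvolutionTwistProofs
import Literature.NumberTheory.EllipticCurves.Sprung2012.SharpFlatSelmerTorsionOfColemanKatoProofs
import Literature.NumberTheory.EllipticCurves.Sprung2012.SharpFlatColemanKatoContragredient
import Literature.NumberTheory.EllipticCurves.IwasawaAlgebraMuAdditiveProofs
import HarnessLib

/-!
# Sprung 2012, Thm. 1.2 / 7.14 (`X^•(E/ℚ_∞)` finitely generated `Λ`-torsion when `L^• ≠ 0`): the torsion
# clause of the named fact `thm714_sharpFlatSelmerDual_finite_torsion` DERIVED from Sprung's exact sequence (3)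
# in the PRINT keying (duals contragredient, key `γ⁻¹`, against the covariant `𝐇¹`) and Kato's Thm. 12.4 (1)
# — proofs only (0 definitions, 0 named facts)

`Proofs` file (theorems only; no definition, no named fact, no `instance`, no notation, no `sorry`) in the
cluster `Sprung2012`, next to `SharpFlatKatoDivisibility.lean` (the NAMED FACT
`thm714_sharpFlatSelmerDual_finite_torsion`: F. Sprung, *Iwasawa theory for elliptic curves at supersingular
primes: A pair of main conjectures*, J. Number Theory **132** (2012) 1483–1506 [Sprung2012], Thm. 1.2
(p. 1486) = Thm. 7.14 (p. 1504) at the trivial tame character: for `E/ℚ`, an odd prime `p` of good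
supersingular reduction, the colour `• ∈ {♯, ♭}` with `L^•_p(E, X) ≠ 0`, and every Pontryagin-dual datum
`D` of `Sel^•(E/ℚ_∞)`, `D.X` is a finitely generated torsion `Λ = ℤ_p⟦T⟧`-module), to
`SharpFlatSelmerTorsionOfColemanKatoProofs.lean` (the same fact derived from the `γ`-KEYED Coleman–Kato
package `thm714seq_sharpFlatColemanKato_zeta`) and to `SharpFlatSelmerDualInvolutionTwistProofs.lean` (the
`γ ↦ γ⁻¹` dictionary). Seat `bsd-input-sp12-thm714-torsion` g0 (21-frontier «inputs → unconditional», row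
F14 of the BSD inputs desk). HONEST FRAMING: an IMPLICATION from typed hypotheses to a named fact; the named
fact is NOT discharged here (no `_holds`); none of Kato's theorems is proved here; nothing is booked; no
census cell moves; no summit statement (BSD) is proved by any of this. AI-typed, kernel-checked; AI review
is weaker than expert review.

## Why this file exists (the keying record, numbers not adjectives)

The only in-tree antecedent of the torsion clause before this file,
`thm714_sharpFlatSelmerDual_finite_torsion_of_colemanKato` (sibling file, §2), consumes the package fact
`thm714seq_sharpFlatColemanKato_zeta`, whose structure `SharpFlatColemanKatoData … κ γ … I` places Sprung's
sequence (3) between the COVARIANT `I : Kato2004.IwasawaH1Data W p κ γ` (`1 + T ↦ conj_γ`) and duals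
`D : SharpFlatSelmerDualData W κ γ …`, `Y : W.FineSelmerDualData κ γ` whose `T` acts by PRE-composition with
`conj_γ` (`toDual_T_smul`) — i.e. the `ι`-twists `(X^•)^ι`, `(X₀)^ι` of the printed modules (Greenberg 1989
pp. 101–102; Nekovář, Astérisque 310, p. 263 and (9.1.4.2); Perrin-Riou, Astérisque 229, §2.5.1 p. 59). The
cell referee reads that package FALSE IN NATURE as typed at every class-X8 curve with a sporadic private zero
(≥ 135 of 217 cells; memo `REF-G24-R250-KEYING-DECIDED` §0 3(a), §2), and the fact
`thm714_sharpFlatSelmerDual_finite_torsion` itself keying-IMMUNE (§0 3(d): torsion-ness is `ι`-invariant —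
the tree theorem `sharpFlatSelmerDualData_isTorsion_inv_iff`). The print-exact repair is the CONTRAGREDIENT
keying (pattern of the landed `Kato2004/*Contragredient` files): duals over `γ⁻¹` against `I` over `γ`.
THIS FILE gives the torsion clause of the `γ`-keyed fact from hypotheses stated in that print keying, so
that the fact regains an honest typed antecedent:

* §1 MODULE ALGEBRA = the two sentences of the printed proof "`Coker(ι)` is killed by `L^∗_p(E, η, X) ≠ 0`
  and is thus `ℤ_p[[X]]`-torsion. Now `X⁰(E/K_∞)^η` is a torsion `ℤ_p[[X]]`-module, so we are done": for
  `Λ →ʲ X → Y` exact at `X` with `j a = 0` for some `a ≠ 0` and `Y` torsion, `X` is torsion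
  (`isTorsion_of_exact_of_apply_eq_zero`; four-term form `isTorsion_of_exact₄_of_apply_ne_zero`).
* §2 THE FINE SIDE AT KEY `γ⁻¹`: `fineSelmerDualData_isTorsion_inv_iff` (`X₀` torsion at key `γ` ↔ at key
  `γ⁻¹`, by `Kato2004.fineSelmerDualData_exists_involTwist` + uniqueness), hence
  `fineSelmerDual_isTorsion_inv_of_kato2004`: under `Kato2004_fineSelmerDual_isTorsion` (Kato Thm. 12.4 (1)
  ∘ (17.13.1), stated for every topological generator — keying-immune) every `Y′ : W.FineSelmerDualData κ γ⁻¹`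
  is torsion.
* §3 `SharpFlatSelmerDualData.isTorsion_of_seq3_contra`: a `γ`-keyed datum `D` is torsion as soon as ONE
  `γ⁻¹`-keyed datum `D′` sits in a sequence `Λ →ʲ D′.X →ᵏ Y′.X`, exact at `D′.X`, with `j a = 0`, `a ≠ 0`,
  and `Y′.X` torsion (§1 + the dictionary); four-term / injective-`col` variants.
* §4 **`thm714_sharpFlatSelmerDual_finite_torsion_of_seq3_contra`**: the NAMED FACT follows from
  (X₁) Sprung's sequence (3) with its first cokernel killed by a non-zero element, in the print keying, for
  the colour with `L^• ≠ 0` — typed INLINE as a hypothesis in the fact's own binder telescope — and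
  (X₂) `Kato2004_fineSelmerDual_isTorsion`. Finite generation is the tree theorem
  `SharpFlatSelmerDualData.moduleFinite` (Nakayama), as in print.
* §5 **`thm714_sharpFlatSelmerDual_finite_torsion_of_colMap_contra`**: the same from the PACKAGE SHAPE of
  the contragredient Coleman–Kato data (the binder telescope of `thm714seq_sharpFlatColemanKato_zeta`
  VERBATIM, conclusion: a `Λ`-linear `colMap : 𝐇¹ → Λ`, injective when `L^• ≠ 0`, and for all `γ⁻¹`-keyed
  `D′`, `Y′` some `j`, `k` making `𝐇¹ → Λ → D′.X → Y′.X → 0` exact) + Kato (12.2.2)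
  (`Kato2004.one_le_rank_iwasawaH1`: `𝐇¹ ≠ 0`) + `Kato2004_fineSelmerDual_isTorsion`, through
  `seq3_contra_of_colMap_contra` (§5 ⟹ X₁). The hypothesis of §5 is, field for field, what the
  contragredient sibling structure `SharpFlatColemanKatoDataContra … κ γ … I` (duals over `γ⁻¹`; file
  `SharpFlatColemanKatoContragredient.lean`, x8 `contra-ty` lane) projects to.
* §6 **THE PRINT-KEYED TWIN OF THE SIBLING FILE**, on the landed structure `SharpFlatColemanKatoDataContra` and
  its existence facts: `SharpFlatColemanKatoDataContra.isTorsion_of_nontrivial` (package form: `𝐇¹ ≠ 0`,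
  `L^• ≠ 0`, a torsion `γ⁻¹`-keyed `X₀` ⟹ every `γ`-keyed AND every `γ⁻¹`-keyed dual datum of `Sel^•` is
  torsion), `…_of_pair`, `….nontrivial_of_normalised` / `….isTorsion_of_normalised` (`𝐇¹ ≠ 0` from `Z ≠ 0` at
  irreducible image with a Néron-normalised generator, no (12.2.2)), and the named fact from the three
  print-keyed / keying-immune named facts:
  **`thm714_sharpFlatSelmerDual_finite_torsion_of_colemanKatoContra
    (hCK : thm714seq_sharpFlatColemanKato_zeta_contra) (hH1 : Kato2004.one_le_rank_iwasawaH1)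
    (hYt : Kato2004_fineSelmerDual_isTorsion) : thm714_sharpFlatSelmerDual_finite_torsion`**,
  `…_of_zetaJointContra` (from the joint print-keyed package), and the class-X8 shape
  `sharpFlatSelmerDual_finite_torsion_of_colemanKatoContra_of_irreducible` (package + Kato Thm. 12.4 (1) alone,
  at `ρ̄_{E,p}` irreducible with `ϖ ≠ 0`).

Nothing here is stronger than print: (3) is printed exact with `ι` injective and `Coker ι` killed by
`L^∗_p ≠ 0` (p. 1504); the hypotheses keep only "exact at `X^∗`", "`j a = 0` for some `a ≠ 0`" (resp.
"`col` injective when `L^• ≠ 0`", "`𝐇¹ ≠ 0`"), never the identity of `a` with `L^•` (period normalisation,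
flag `Sp12-716-period` of `SharpFlatKatoDivisibility.lean`).

## What is NOT here
No discharge of (X₁)/(X₂)/(12.2.2) (Poitou–Tate along the tower, Honda theory §2, Kato §§8–17: size XL, none
in Mathlib); no statement about `Char X^•` (Thm. 7.16 — keying-EXPOSED, separate sibling); no new `def`.

References: [Sprung2012] Thm. 1.2 (p. 1486), Def. 7.11–7.13 (p. 1503–1504), Thm. 7.14 with (3) (p. 1504),
Prop. 7.19 (p. 1505); [Kobayashi2003] S. Kobayashi, Invent. Math. 152 (2003), Prop. 7.1, Cor. 7.2, Thm. 7.3 i)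
(pp. 12–13); [Kato2004Asterisque] K. Kato, Astérisque 295 (2004), §12.2 (12.2.1)–(12.2.2) (p. 220), Thm. 12.4
(p. 221), (17.13.1) (p. 279); [GreenbergLNM1716] §1 p. 60; [Greenberg1989] §0 pp. 101–102; J. Nekovář,
*Selmer complexes*, Astérisque 310 (2006), p. 263, (9.1.4.2); B. Perrin-Riou, Astérisque 229 (1995), §2.5.1
(p. 59); cell records `run/shared/lean/pub/bsd-print-x8/ref/REF-G24-R250-KEYING-DECIDED.md`,
`…/bsd-print-x8/DOSSIER.md` T69.
-/

noncomputable section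

open scoped Classical MatrixGroups ModularForm NumberField

open CongruenceSubgroup WeierstrassCurve Field NumberField IsDedekindDomain
  Literature.NumberTheory.EllipticCurves Literature.NumberTheory.EllipticCurves.ModularForms
  Literature.NumberTheory.GaloisRepresentations ZpExtension
  Literature.NumberTheory.EllipticCurves.IwasawaAlgebra Literature.NumberTheory.EllipticCurves.Sprung2017

universe u

namespace Literature.NumberTheory.EllipticCurves.Sprung2012

/-! ## §1 Module algebra: "`Coker(ι)` is killed by `L^∗ ≠ 0` … `X⁰` is torsion, so we are done" -/

section Algebra

variable {R : Type*} [CommRing R] [IsDomain R] {H X Y : Type*} [AddCommGroup H] [Module R H]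
  [AddCommGroup X] [Module R X] [AddCommGroup Y] [Module R Y]

/-- **Three-term torsion lemma** (the last two sentences of the proof of Sprung's Thm. 7.14, p. 1504, as
module algebra over a domain `R`): if `R →ʲ X →ᵏ Y` is exact at `X`, `j` kills a non-zero `a ∈ R` (so the
image of `j`, a quotient of `R/(a)`, is torsion) and `Y` is torsion, then `X` is torsion. For `x ∈ X` take
`b ≠ 0` with `b·k(x) = 0`; then `b·x = j(l)` and `(a b)·x = a·j(l) = l·j(a) = 0`.
[cite: Sprung2012, Thm. 7.14, proof (p. 1504): "Coker(ι) is killed by L^∗_p(E, η, X) ≠ 0 and is thus ℤ_p[[X]]-torsion. Now X⁰(E/K_∞)^η is a torsion ℤ_p[[X]]-module, so we are done."] -/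
theorem isTorsion_of_exact_of_apply_eq_zero (j : R →ₗ[R] X) (k : X →ₗ[R] Y)
    (hjk : Function.Exact j k) {a : R} (ha : a ≠ 0) (hja : j a = 0)
    (hY : Module.IsTorsion R Y) : Module.IsTorsion R X := by
  intro x
  obtain ⟨b, hb⟩ := @hY (k x)
  have hkx : k ((b : R) • x) = 0 := by rw [map_smul, ← Submonoid.smul_def, hb]
  obtain ⟨l, hl⟩ := (hjk ((b : R) • x)).mp hkx
  refine ⟨⟨a * b, mem_nonZeroDivisors_of_ne_zero
    (mul_ne_zero ha (nonZeroDivisors.ne_zero b.2))⟩, ?_⟩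
  rw [Submonoid.smul_def, mul_smul, ← hl, ← map_smul, smul_eq_mul, mul_comm, ← smul_eq_mul,
    map_smul, hja, smul_zero]

/-- **Four-term torsion lemma** (Sprung's (3) `𝐇¹ →ᶜ Λ →ʲ X^∗ →ᵏ X⁰`, p. 1504, as module algebra): if
`H →ᶜ R →ʲ X →ᵏ Y` is exact at `R` and at `X`, `c` takes a non-zero value, and `Y` is torsion, then `X`
is torsion (`j (c e) = 0` by exactness at `R`; then the three-term lemma). Weaker hypotheses than the
sibling `Kobayashi2003.isTorsion_of_exact_of_injective_of_ne_zero` (no injectivity of `c` needed).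
[cite: Sprung2012, Thm. 7.14 with (3) (p. 1504)] -/
theorem isTorsion_of_exact₄_of_apply_ne_zero (c : H →ₗ[R] R) (j : R →ₗ[R] X) (k : X →ₗ[R] Y)
    (hcj : Function.Exact c j) (hjk : Function.Exact j k) {e : H} (he : c e ≠ 0)
    (hY : Module.IsTorsion R Y) : Module.IsTorsion R X :=
  isTorsion_of_exact_of_apply_eq_zero j k hjk he ((hcj (c e)).mpr ⟨e, rfl⟩) hY

/-- The injective form (the shape of the Coleman–Kato packages: `col` injective and `𝐇¹ ≠ 0`): if
`H →ᶜ R →ʲ X →ᵏ Y` is exact at `R` and `X`, `c` is injective, `H` is non-trivial and `Y` is torsion, then `X`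
is torsion. [cite: Sprung2012, Thm. 7.14 with (3) (p. 1504)] -/
theorem isTorsion_of_exact₄_of_injective (c : H →ₗ[R] R) (j : R →ₗ[R] X) (k : X →ₗ[R] Y)
    (hcj : Function.Exact c j) (hjk : Function.Exact j k) (hc : Function.Injective c) [Nontrivial H]
    (hY : Module.IsTorsion R Y) : Module.IsTorsion R X := by
  obtain ⟨e, he⟩ := exists_ne (0 : H)
  have hce : c e ≠ 0 := fun h ↦ he (hc (by rw [h, map_zero]))
  exact isTorsion_of_exact₄_of_apply_ne_zero c j k hcj hjk hce hY

end Algebra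

/-! ## §2 The fine side at key `γ⁻¹`: `X₀` torsion is keying-immune -/

section Fine

variable {K : Type u} [Field K] [NumberField K] {W : WeierstrassCurve K} {p : ℕ} [Fact p.Prime]
  {κ : ZpExtension K p} {γ : Field.absoluteGaloisGroup K}

/-- **`X₀(E/K_∞)` torsion at key `γ` ↔ at key `γ⁻¹`**: for ANY dual fine Selmer data `Y` of key `γ` and
`Y′` of key `γ⁻¹`, `Y.X` is `Λ`-torsion iff `Y′.X` is (`Y′ ≃ (Y)^ι` by
`Kato2004.fineSelmerDualData_exists_involTwist` and uniqueness at key `γ⁻¹`; torsion passes along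
`ι`-semilinear and linear isomorphisms). The fine twin of `sharpFlatSelmerDualData_isTorsion_inv_iff`.
[cite: GreenbergLNM1716, §1 (p. 60)] [cite: Greenberg1989, §0 pp. 101–102] -/
theorem fineSelmerDualData_isTorsion_inv_iff (Y : W.FineSelmerDualData κ γ)
    (Y' : W.FineSelmerDualData κ γ⁻¹) :
    Module.IsTorsion (IwasawaAlgebra p) Y.X ↔ Module.IsTorsion (IwasawaAlgebra p) Y'.X := by
  obtain ⟨Y₁, e, he, -⟩ := Kato2004.fineSelmerDualData_exists_involTwist (mul_inv_cancel γ) Y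
  obtain ⟨Y₂, e₂, he₂, -⟩ := Kato2004.fineSelmerDualData_exists_involTwist (inv_mul_cancel γ) Y'
  obtain ⟨e₁'⟩ := WeierstrassCurve.FineSelmerDualData.nonempty_linearEquiv Y₁ Y'
  obtain ⟨e₂'⟩ := WeierstrassCurve.FineSelmerDualData.nonempty_linearEquiv Y₂ Y
  exact ⟨fun h ↦ isTorsion_of_surjective e₁'.toLinearMap e₁'.surjective
      (Kato2004.isTorsion_of_involSemilinear h e he),
    fun h ↦ isTorsion_of_surjective e₂'.toLinearMap e₂'.surjective
      (Kato2004.isTorsion_of_involSemilinear h e₂ he₂)⟩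

/-- **Under Kato's Thm. 12.4 (1) ∘ (17.13.1) (`Kato2004_fineSelmerDual_isTorsion`, stated for every
topological generator), the CONTRAGREDIENT dual fine Selmer group is torsion too**: for `W/ℚ` elliptic, the
cyclotomic `κ` with topological generator `γ`, every `Y′ : W.FineSelmerDualData κ γ⁻¹` has `Y′.X` torsion.
[cite: Kato2004Asterisque, Thm. 12.4 (1) (p. 221) and (17.13.1) (p. 279)] [cite: GreenbergLNM1716, §1 (p. 60)] -/
theorem fineSelmerDual_isTorsion_inv_of_kato2004 (h : Kato2004_fineSelmerDual_isTorsion)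
    (W : WeierstrassCurve ℚ) [W.IsElliptic] (p : ℕ) [Fact p.Prime] {κ : ZpExtension ℚ p}
    {γ : Field.absoluteGaloisGroup ℚ} (hκ : κ.IsCyclotomic) (hγ : κ.IsTopGenerator γ)
    (Y' : W.FineSelmerDualData κ γ⁻¹) : Module.IsTorsion (IwasawaAlgebra p) Y'.X := by
  obtain ⟨Y⟩ := W.nonempty_fineSelmerDualData κ hγ
  exact (fineSelmerDualData_isTorsion_inv_iff Y Y').mp (h W p κ γ hκ hγ Y)

end Fine

/-! ## §3 A `γ`-keyed `X^•` is torsion once a `γ⁻¹`-keyed one sits in Sprung's (3) with torsion ends -/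

section Contra

variable {K : Type u} [Field K] [NumberField K] {W : WeierstrassCurve K} {p : ℕ} [Fact p.Prime]
  {κ : ZpExtension K p} {γ : Field.absoluteGaloisGroup K} {E : Type u} [Field E] [Algebra K E]
  {ι : AlgebraicClosure K →ₐ[K] AlgebraicClosure E} {ap : ℤ} {g : Field.absoluteGaloisGroup E}
  {c : ℕ → localPoints W E} {col : Chroma}

/-- **Sprung's Thm. 7.14, torsion clause, in the tree's key `γ` from the PRINT-keyed sequence**: let
`D : SharpFlatSelmerDualData W κ γ …` (the tree's `(X^•)^ι`), and suppose some contragredient datum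
`D′ : SharpFlatSelmerDualData W κ γ⁻¹ …` (print's `X^•`) and some `Y′ : W.FineSelmerDualData κ γ⁻¹` (print's
`X₀`) sit in `Λ →ʲ D′.X →ᵏ Y′.X`, exact at `D′.X`, with `j a = 0` for a non-zero `a` ("`Coker(ι)` is killed
by `L^∗ ≠ 0`") and `Y′.X` torsion ([Kobayashi, Cor. 7.2]). Then `D.X` is `Λ`-torsion (§1, then the
dictionary `sharpFlatSelmerDualData_isTorsion_inv_iff`).
[cite: Sprung2012, Thm. 7.14 with (3) (p. 1504)] [cite: GreenbergLNM1716, §1 (p. 60)] -/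
theorem SharpFlatSelmerDualData.isTorsion_of_seq3_contra (D : SharpFlatSelmerDualData W κ γ ι ap g c col)
    (D' : SharpFlatSelmerDualData W κ γ⁻¹ ι ap g c col) (Y' : W.FineSelmerDualData κ γ⁻¹)
    (j : IwasawaAlgebra p →ₗ[IwasawaAlgebra p] D'.X) (k : D'.X →ₗ[IwasawaAlgebra p] Y'.X)
    (hjk : Function.Exact j k) {a : IwasawaAlgebra p} (ha : a ≠ 0) (hja : j a = 0)
    (hY' : Module.IsTorsion (IwasawaAlgebra p) Y'.X) : Module.IsTorsion (IwasawaAlgebra p) D.X :=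
  (sharpFlatSelmerDualData_isTorsion_inv_iff D D').mpr
    (isTorsion_of_exact_of_apply_eq_zero j k hjk ha hja hY')

/-- The four-term form: `𝐇 →ᶜ Λ →ʲ D′.X →ᵏ Y′.X` exact at `Λ` and at `D′.X` (print's (3) with Props. 7.3/7.6
composed in), `c` taking a non-zero value, `Y′.X` torsion ⟹ the `γ`-keyed `D.X` is torsion.
[cite: Sprung2012, Thm. 7.14 with (3) (p. 1504)] [cite: GreenbergLNM1716, §1 (p. 60)] -/
theorem SharpFlatSelmerDualData.isTorsion_of_exact₄_contra {H : Type*} [AddCommGroup H]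
    [Module (IwasawaAlgebra p) H] (D : SharpFlatSelmerDualData W κ γ ι ap g c col)
    (D' : SharpFlatSelmerDualData W κ γ⁻¹ ι ap g c col) (Y' : W.FineSelmerDualData κ γ⁻¹)
    (cm : H →ₗ[IwasawaAlgebra p] IwasawaAlgebra p) (j : IwasawaAlgebra p →ₗ[IwasawaAlgebra p] D'.X)
    (k : D'.X →ₗ[IwasawaAlgebra p] Y'.X) (hcj : Function.Exact cm j) (hjk : Function.Exact j k)
    {e : H} (he : cm e ≠ 0) (hY' : Module.IsTorsion (IwasawaAlgebra p) Y'.X) :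
    Module.IsTorsion (IwasawaAlgebra p) D.X :=
  (sharpFlatSelmerDualData_isTorsion_inv_iff D D').mpr
    (isTorsion_of_exact₄_of_apply_ne_zero cm j k hcj hjk he hY')

/-- The package form: `𝐇 →ᶜ Λ →ʲ D′.X →ᵏ Y′.X` exact at `Λ` and `D′.X`, `c` injective, `𝐇` non-trivial,
`Y′.X` torsion ⟹ the `γ`-keyed `D.X` is torsion. [cite: Sprung2012, Thm. 7.14 with (3) (p. 1504)]
[cite: GreenbergLNM1716, §1 (p. 60)] -/
theorem SharpFlatSelmerDualData.isTorsion_of_injective_contra {H : Type*} [AddCommGroup H]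
    [Module (IwasawaAlgebra p) H] [Nontrivial H] (D : SharpFlatSelmerDualData W κ γ ι ap g c col)
    (D' : SharpFlatSelmerDualData W κ γ⁻¹ ι ap g c col) (Y' : W.FineSelmerDualData κ γ⁻¹)
    (cm : H →ₗ[IwasawaAlgebra p] IwasawaAlgebra p) (j : IwasawaAlgebra p →ₗ[IwasawaAlgebra p] D'.X)
    (k : D'.X →ₗ[IwasawaAlgebra p] Y'.X) (hcj : Function.Exact cm j) (hjk : Function.Exact j k)
    (hc : Function.Injective cm) (hY' : Module.IsTorsion (IwasawaAlgebra p) Y'.X) :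
    Module.IsTorsion (IwasawaAlgebra p) D.X :=
  (sharpFlatSelmerDualData_isTorsion_inv_iff D D').mpr
    (isTorsion_of_exact₄_of_injective cm j k hcj hjk hc hY')

end Contra

/-! ## §4 The named fact from Sprung's (3) in the print keying + Kato's Thm. 12.4 (1) -/

/-- **Sprung 2012 Thm. 1.2 / 7.14 DERIVED from its printed proof, print keying.** The named fact
`thm714_sharpFlatSelmerDual_finite_torsion` follows from two hypotheses:
(X₁) `hseq` — in the binder telescope of the fact (globally minimal elliptic `W/ℚ`; `p ≠ 2` of good
reduction with `p ∣ a_p`; a newform `f` of `W`; the cyclotomic `κ` with topological generator `γ` matching the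
cyclotomic variable; the place `v ∋ p`, a local lift `g` of `γ`, a Honda system `(cneg, c)`; a colour `•` and
a Sprung pair `(L♯, L♭)` with `L^• ≠ 0`), for EVERY contragredient dual datum
`D′ : SharpFlatSelmerDualData W κ γ⁻¹ …` of `Sel^•(E/ℚ_∞)` and EVERY `Y′ : W.FineSelmerDualData κ γ⁻¹` of
`Sel₀(ℚ_∞, E[p^∞])` there are `Λ`-linear `j : Λ → D′.X`, `k : D′.X → Y′.X` with `Λ →ʲ X^• →ᵏ X₀` exact at
`X^•` and `j a = 0` for some `a ≠ 0` — Sprung's sequence (3) `0 → 𝐇¹(T) →^ι 𝐇¹_Iw(T)/Ker ε₁Col^∗ → X^∗ →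
X⁰ → 0` (p. 1504, `η = 1`; `𝐇¹_Iw/Ker ε₁Col^∗ ≅ Λ` by Props. 7.3/7.6) together with "`Coker(ι)` is killed
by `L^∗_p(E, η, X) ≠ 0`", read in the Nekovář/Perrin-Riou (contragredient) convention for the duals;
(X₂) `hYt` — `Kato2004_fineSelmerDual_isTorsion` (Kato Thm. 12.4 (1) ∘ (17.13.1) = [Kobayashi, Cor. 7.2]:
`X⁰` torsion). Proof = print: finite generation by Nakayama (`SharpFlatSelmerDualData.moduleFinite`);
torsion of the `γ⁻¹`-keyed `X^•` by §1, transported to the fact's `γ`-keyed datum by the dictionary (§3),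
the `γ⁻¹`-keyed `X₀` being torsion by §2. An implication; neither hypothesis is discharged here.
[cite: Sprung2012, Thm. 1.2 (p. 1486), Thm. 7.14 with (3) (p. 1504), Prop. 7.3 (p. 1500), Prop. 7.6 (p. 1501)]
[cite: Kato2004Asterisque, Thm. 12.4 (1) (p. 221)] [cite: Kobayashi2003, Cor. 7.2 and Thm. 7.3 i) (p. 13)] -/
theorem thm714_sharpFlatSelmerDual_finite_torsion_of_seq3_contra
    (hseq : ∀ (W : WeierstrassCurve ℚ) [W.IsElliptic] [W.IsGloballyMinimal] (p : ℕ) [Fact p.Prime],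
      p ≠ 2 → W.HasGoodReductionAtPrime p → (p : ℤ) ∣ W.frobeniusTrace p →
      ∀ {N : ℕ} [NeZero N] (f : CuspForm (Gamma0 N) 2), IsNewformOf W f →
      ∀ (κ : ZpExtension ℚ p) (γ : Field.absoluteGaloisGroup ℚ),
        κ.IsCyclotomic → κ.IsTopGenerator γ → IsCyclotomicVariable p γ →
      ∀ (v : HeightOneSpectrum (𝓞 ℚ)), (p : 𝓞 ℚ) ∈ v.asIdeal →
      ∀ (g : Field.absoluteGaloisGroup (v.adicCompletion ℚ)),
        κ.IsTopGenerator (resGalOfEmb (closureEmb (K := ℚ) (v.adicCompletion ℚ)) g) →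
      ∀ (cneg : localPoints W (v.adicCompletion ℚ)) (c : ℕ → localPoints W (v.adicCompletion ℚ)),
        IsHondaSystem κ (closureEmb (K := ℚ) (v.adicCompletion ℚ)) W (W.frobeniusTrace p) g cneg c →
      ∀ (col : Chroma) (Lsharp Lflat : IwasawaAlgebra p),
        IsSprungPair f p (W.frobeniusTrace p) Lsharp Lflat → chromaticL col Lsharp Lflat ≠ 0 →
      ∀ (D' : SharpFlatSelmerDualData W κ γ⁻¹ (closureEmb (K := ℚ) (v.adicCompletion ℚ))
          (W.frobeniusTrace p) g c col) (Y' : W.FineSelmerDualData κ γ⁻¹),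
        ∃ (j : IwasawaAlgebra p →ₗ[IwasawaAlgebra p] D'.X) (k : D'.X →ₗ[IwasawaAlgebra p] Y'.X)
          (a : IwasawaAlgebra p), Function.Exact j k ∧ a ≠ 0 ∧ j a = 0)
    (hYt : Kato2004_fineSelmerDual_isTorsion) :
    thm714_sharpFlatSelmerDual_finite_torsion := by
  intro W _ _ p _ hp hgood hss N _ f hf κ γ hκ hγ hγ' v hv g hg cneg c hH col Lsharp Lflat hL hL0 D
  refine ⟨D.moduleFinite hγ, ?_⟩
  obtain ⟨D'⟩ := nonempty_sharpFlatSelmerDualData_of_mul_eq_one (mul_inv_cancel γ) D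
  obtain ⟨Y'⟩ := W.nonempty_fineSelmerDualData' κ γ⁻¹
  obtain ⟨j, k, a, hjk, ha, hja⟩ :=
    hseq W p hp hgood hss f hf κ γ hκ hγ hγ' v hv g hg cneg c hH col Lsharp Lflat hL hL0 D' Y'
  exact D.isTorsion_of_seq3_contra D' Y' j k hjk ha hja
    (fineSelmerDual_isTorsion_inv_of_kato2004 hYt W p hκ hγ Y')

/-! ## §5 The named fact from the contragredient PACKAGE shape + Kato (12.2.2) + Kato Thm. 12.4 (1) -/

/-- **The package shape implies (X₁).** In the binder telescope of `thm714seq_sharpFlatColemanKato_zeta`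
VERBATIM (structure facts of `T_pW` as instance binders, a newform `f` with period ratio `ϖ`, the cyclotomic
`(κ, γ)`, the place `v ∋ p`, `g`, a Honda system, a colour `•`, Kato's pinned `I : Kato2004.IwasawaH1Data W p κ γ`
— COVARIANT, `1 + T ↦ conj_γ`), suppose (`hCK`) a `Λ`-linear `colMap : 𝐇¹ → Λ` exists, injective whenever a
Sprung pair has `L^• ≠ 0` (the arrow `ι` of (3)), such that for all CONTRAGREDIENT duals
`D′ : SharpFlatSelmerDualData W κ γ⁻¹ …`, `Y′ : W.FineSelmerDualData κ γ⁻¹` some `j`, `k` make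
`𝐇¹ →ᶜᵒˡ Λ →ʲ D′.X →ᵏ Y′.X → 0` exact — exactly the fields `colMap`/`colMap_injective`/`exact` of the tree's
`SharpFlatColemanKatoData` with the two dual binders re-keyed over `γ⁻¹` (the print keying; pattern of
`Kato2004.DivisibilityInputsContra`). Then, granted Kato's (12.2.2) (`Kato2004.one_le_rank_iwasawaH1`:
`𝐇¹_Γ(T_pW) ≠ 0`), hypothesis (X₁) of §4 holds: `a := colMap e` for any `e ≠ 0` in `𝐇¹`. (The period ratio
`ϖ` of `f` is supplied by `ModularParametrizationData.exists_rat_mul_realPeriodRat_eq_plusPeriod`, the pin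
`I` by `Kato2004.nonempty_iwasawaH1Data_holds`, the `T_pW` instances by the tree theorems — as in the sibling
`thm714_sharpFlatSelmerDual_finite_torsion_of_colemanKato`.)
[cite: Sprung2012, Thm. 7.14 with (3) (p. 1504), Prop. 7.3 (p. 1500), Prop. 7.6 (p. 1501)]
[cite: Kato2004Asterisque, §12.2 (12.2.1)–(12.2.2) (p. 220)] -/
theorem seq3_contra_of_colMap_contra
    (hCK : ∀ (W : WeierstrassCurve ℚ) [W.IsElliptic] [W.IsGloballyMinimal] (p : ℕ) [Fact p.Prime]
      [ContinuousSMul ℤ_[p] (W.tateModule p)] [Module.Free ℤ_[p] (W.tateModule p)]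
      [Module.Finite ℤ_[p] (W.tateModule p)] {N : ℕ} [NeZero N] (f : CuspForm (Gamma0 N) 2) (ϖ : ℚ)
      (κ : ZpExtension ℚ p) (γ : absoluteGaloisGroup ℚ),
      p ≠ 2 → W.HasGoodReductionAtPrime p → (p : ℤ) ∣ W.frobeniusTrace p → IsNewformOf W f →
      (ϖ : ℝ) * W.realPeriodRat = plusPeriod f →
      κ.IsCyclotomic → κ.IsTopGenerator γ → IsCyclotomicVariable p γ →
      ∀ (v : HeightOneSpectrum (𝓞 ℚ)), (p : 𝓞 ℚ) ∈ v.asIdeal →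
      ∀ (g : absoluteGaloisGroup (v.adicCompletion ℚ)),
        κ.IsTopGenerator (resGalOfEmb (closureEmb (K := ℚ) (v.adicCompletion ℚ)) g) →
      ∀ (cneg : localPoints W (v.adicCompletion ℚ)) (c : ℕ → localPoints W (v.adicCompletion ℚ)),
        IsHondaSystem κ (closureEmb (K := ℚ) (v.adicCompletion ℚ)) W (W.frobeniusTrace p) g cneg c →
      ∀ (col : Chroma) (I : Kato2004.IwasawaH1Data W p κ γ),
        ∃ colMap : I.H →ₗ[IwasawaAlgebra p] IwasawaAlgebra p,
          (∀ (Lsharp Lflat : IwasawaAlgebra p), IsSprungPair f p (W.frobeniusTrace p) Lsharp Lflat →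
            chromaticL col Lsharp Lflat ≠ 0 → Function.Injective colMap) ∧
          ∀ (D' : SharpFlatSelmerDualData W κ γ⁻¹ (closureEmb (K := ℚ) (v.adicCompletion ℚ))
              (W.frobeniusTrace p) g c col) (Y' : W.FineSelmerDualData κ γ⁻¹),
            ∃ (j : IwasawaAlgebra p →ₗ[IwasawaAlgebra p] D'.X) (k : D'.X →ₗ[IwasawaAlgebra p] Y'.X),
              Function.Exact colMap j ∧ Function.Exact j k ∧ Function.Surjective k)
    (hH1 : Kato2004.one_le_rank_iwasawaH1) :
    ∀ (W : WeierstrassCurve ℚ) [W.IsElliptic] [W.IsGloballyMinimal] (p : ℕ) [Fact p.Prime],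
      p ≠ 2 → W.HasGoodReductionAtPrime p → (p : ℤ) ∣ W.frobeniusTrace p →
      ∀ {N : ℕ} [NeZero N] (f : CuspForm (Gamma0 N) 2), IsNewformOf W f →
      ∀ (κ : ZpExtension ℚ p) (γ : Field.absoluteGaloisGroup ℚ),
        κ.IsCyclotomic → κ.IsTopGenerator γ → IsCyclotomicVariable p γ →
      ∀ (v : HeightOneSpectrum (𝓞 ℚ)), (p : 𝓞 ℚ) ∈ v.asIdeal →
      ∀ (g : Field.absoluteGaloisGroup (v.adicCompletion ℚ)),
        κ.IsTopGenerator (resGalOfEmb (closureEmb (K := ℚ) (v.adicCompletion ℚ)) g) →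
      ∀ (cneg : localPoints W (v.adicCompletion ℚ)) (c : ℕ → localPoints W (v.adicCompletion ℚ)),
        IsHondaSystem κ (closureEmb (K := ℚ) (v.adicCompletion ℚ)) W (W.frobeniusTrace p) g cneg c →
      ∀ (col : Chroma) (Lsharp Lflat : IwasawaAlgebra p),
        IsSprungPair f p (W.frobeniusTrace p) Lsharp Lflat → chromaticL col Lsharp Lflat ≠ 0 →
      ∀ (D' : SharpFlatSelmerDualData W κ γ⁻¹ (closureEmb (K := ℚ) (v.adicCompletion ℚ))
          (W.frobeniusTrace p) g c col) (Y' : W.FineSelmerDualData κ γ⁻¹),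
        ∃ (j : IwasawaAlgebra p →ₗ[IwasawaAlgebra p] D'.X) (k : D'.X →ₗ[IwasawaAlgebra p] Y'.X)
          (a : IwasawaAlgebra p), Function.Exact j k ∧ a ≠ 0 ∧ j a = 0 := by
  intro W _ _ p _ hp hgood hss N _ f hf κ γ hκ hγ hγ' v hv g hg cneg c hH col Lsharp Lflat hL hL0 D' Y'
  -- the period ratio of the newform `f`
  obtain ⟨Dm⟩ := Literature.NumberTheory.Automorphic.nonempty_modularParametrizationData_of_isNewformOf hf
  obtain ⟨ϖ, -, hϖ, -⟩ := Dm.exists_rat_mul_realPeriodRat_eq_plusPeriod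
  rw [Dm.isNewformOf.unique hf] at hϖ
  -- pins: `T_pW` structure facts, `𝐇¹_Γ` (non-trivial by (12.2.2))
  haveI : ContinuousSMul ℤ_[p] (W.tateModule p) := TateModule.continuousSMul_padicInt
  haveI : Module.Free ℤ_[p] (W.tateModule p) := W.module_free_tateModule_holds p
  haveI : Module.Finite ℤ_[p] (W.tateModule p) := W.module_finite_tateModule_holds p
  obtain ⟨I⟩ := Kato2004.nonempty_iwasawaH1Data_holds W p κ γ hκ hγ
  haveI : Nontrivial I.H := Kato2004.nontrivial_of_one_le_rank_iwasawaH1 hH1 W p κ γ hκ hγ I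
  obtain ⟨colMap, hinj, hex⟩ := hCK W p f ϖ κ γ hp hgood hss hf hϖ hκ hγ hγ' v hv g hg cneg c hH col I
  obtain ⟨j, k, hcj, hjk, -⟩ := hex D' Y'
  obtain ⟨e, he⟩ := exists_ne (0 : I.H)
  have hce : colMap e ≠ 0 := fun h ↦ he (hinj Lsharp Lflat hL hL0 (by rw [h, map_zero]))
  exact ⟨j, k, colMap e, hjk, hce, (hcj (colMap e)).mpr ⟨e, rfl⟩⟩

/-- **Sprung 2012 Thm. 1.2 / 7.14 from the contragredient Coleman–Kato package shape and Kato's §12**: the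
named fact `thm714_sharpFlatSelmerDual_finite_torsion` follows from `hCK` (the shape of §5's
`seq3_contra_of_colMap_contra`: `colMap : 𝐇¹ → Λ` injective when `L^• ≠ 0`, sequence (3) exact for all
`γ⁻¹`-keyed duals — Def. 6.1, Props. 7.3/7.6 and (3) of Thm. 7.14, print keying), `hH1` — Kato (12.2.2)
(`Kato2004.one_le_rank_iwasawaH1`), and `hYt` — Kato Thm. 12.4 (1) ∘ (17.13.1)
(`Kato2004_fineSelmerDual_isTorsion`). The print-keyed twin of
`thm714_sharpFlatSelmerDual_finite_torsion_of_colemanKato`; an implication between typed statements, none of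
the three discharged here. [cite: Sprung2012, Thm. 1.2 (p. 1486), Thm. 7.14 with (3) (p. 1504)]
[cite: Kato2004Asterisque, §12.2 (12.2.2) (p. 220), Thm. 12.4 (1) (p. 221)] -/
theorem thm714_sharpFlatSelmerDual_finite_torsion_of_colMap_contra
    (hCK : ∀ (W : WeierstrassCurve ℚ) [W.IsElliptic] [W.IsGloballyMinimal] (p : ℕ) [Fact p.Prime]
      [ContinuousSMul ℤ_[p] (W.tateModule p)] [Module.Free ℤ_[p] (W.tateModule p)]
      [Module.Finite ℤ_[p] (W.tateModule p)] {N : ℕ} [NeZero N] (f : CuspForm (Gamma0 N) 2) (ϖ : ℚ)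
      (κ : ZpExtension ℚ p) (γ : absoluteGaloisGroup ℚ),
      p ≠ 2 → W.HasGoodReductionAtPrime p → (p : ℤ) ∣ W.frobeniusTrace p → IsNewformOf W f →
      (ϖ : ℝ) * W.realPeriodRat = plusPeriod f →
      κ.IsCyclotomic → κ.IsTopGenerator γ → IsCyclotomicVariable p γ →
      ∀ (v : HeightOneSpectrum (𝓞 ℚ)), (p : 𝓞 ℚ) ∈ v.asIdeal →
      ∀ (g : absoluteGaloisGroup (v.adicCompletion ℚ)),
        κ.IsTopGenerator (resGalOfEmb (closureEmb (K := ℚ) (v.adicCompletion ℚ)) g) →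
      ∀ (cneg : localPoints W (v.adicCompletion ℚ)) (c : ℕ → localPoints W (v.adicCompletion ℚ)),
        IsHondaSystem κ (closureEmb (K := ℚ) (v.adicCompletion ℚ)) W (W.frobeniusTrace p) g cneg c →
      ∀ (col : Chroma) (I : Kato2004.IwasawaH1Data W p κ γ),
        ∃ colMap : I.H →ₗ[IwasawaAlgebra p] IwasawaAlgebra p,
          (∀ (Lsharp Lflat : IwasawaAlgebra p), IsSprungPair f p (W.frobeniusTrace p) Lsharp Lflat →
            chromaticL col Lsharp Lflat ≠ 0 → Function.Injective colMap) ∧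
          ∀ (D' : SharpFlatSelmerDualData W κ γ⁻¹ (closureEmb (K := ℚ) (v.adicCompletion ℚ))
              (W.frobeniusTrace p) g c col) (Y' : W.FineSelmerDualData κ γ⁻¹),
            ∃ (j : IwasawaAlgebra p →ₗ[IwasawaAlgebra p] D'.X) (k : D'.X →ₗ[IwasawaAlgebra p] Y'.X),
              Function.Exact colMap j ∧ Function.Exact j k ∧ Function.Surjective k)
    (hH1 : Kato2004.one_le_rank_iwasawaH1) (hYt : Kato2004_fineSelmerDual_isTorsion) :
    thm714_sharpFlatSelmerDual_finite_torsion :=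
  thm714_sharpFlatSelmerDual_finite_torsion_of_seq3_contra (seq3_contra_of_colMap_contra hCK hH1) hYt

/-! ## §6 The print-keyed twin of `SharpFlatSelmerTorsionOfColemanKatoProofs`: the named fact from the landed
contragredient package `SharpFlatColemanKatoDataContra` / `thm714seq_sharpFlatColemanKato_zeta_contra` -/

section PackageContra

variable {W : WeierstrassCurve ℚ} [W.IsElliptic] {p : ℕ} [Fact p.Prime]
  [ContinuousSMul ℤ_[p] (W.tateModule p)] [Module.Free ℤ_[p] (W.tateModule p)]
  [Module.Finite ℤ_[p] (W.tateModule p)] {N : ℕ} {f : CuspForm (Gamma0 N) 2} {ϖ : ℚ}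
  {κ : ZpExtension ℚ p} {γ : absoluteGaloisGroup ℚ}
  {E : Type} [Field E] [Algebra ℚ E] {ι : AlgebraicClosure ℚ →ₐ[ℚ] AlgebraicClosure E} {ap : ℤ}
  {g : absoluteGaloisGroup E} {c : ℕ → localPoints W E} {col : Chroma}
  {I : Kato2004.IwasawaH1Data W p κ γ}

/-- **Sprung Thm. 7.14 (torsion clause) from the colour-`•` CONTRAGREDIENT Coleman–Kato package, for the
print-keyed dual**: given `C : SharpFlatColemanKatoDataContra W p f ϖ κ γ ι ap g c • I` (sequence (3) for every
`γ⁻¹`-keyed dual datum, `colMap` injective for a Sprung pair with `L^• ≠ 0`), if `𝐇¹_Γ(T_pW) ≠ 0` and some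
`γ⁻¹`-keyed dual fine Selmer datum `Y′` is torsion, then EVERY `γ⁻¹`-keyed dual datum `D′` of `Sel^•(E/ℚ_∞)`
(print's `X^•`) is torsion — §1 along `𝐇¹ →ᶜᵒˡ Λ → D′.X → Y′.X`.
[cite: Sprung2012, Thm. 7.14 with (3) (p. 1504)] -/
theorem SharpFlatColemanKatoDataContra.isTorsion_inv_of_nontrivial
    (C : SharpFlatColemanKatoDataContra W p f ϖ κ γ ι ap g c col I) [Nontrivial I.H]
    {Lsharp Lflat : IwasawaAlgebra p} (hL : IsSprungPair f p ap Lsharp Lflat)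
    (hL0 : chromaticL col Lsharp Lflat ≠ 0) (Y' : W.FineSelmerDualData κ γ⁻¹)
    (hY' : Module.IsTorsion (IwasawaAlgebra p) Y'.X) (D' : SharpFlatSelmerDualData W κ γ⁻¹ ι ap g c col) :
    Module.IsTorsion (IwasawaAlgebra p) D'.X := by
  obtain ⟨j, k, hcj, hjk, -⟩ := C.exact D' Y'
  exact isTorsion_of_exact₄_of_injective C.colMap j k hcj hjk (C.colMap_injective Lsharp Lflat hL hL0) hY'

/-- **The same for the tree-keyed dual** (the binder of the named fact): under the hypotheses of
`isTorsion_inv_of_nontrivial`, EVERY `γ`-keyed dual datum `D` of `Sel^•(E/ℚ_∞)` (the tree's `(X^•)^ι`) is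
torsion (dictionary `sharpFlatSelmerDualData_isTorsion_inv_iff`, through the twisted datum
`nonempty_sharpFlatSelmerDualData_of_mul_eq_one`). [cite: Sprung2012, Thm. 7.14 with (3) (p. 1504)]
[cite: GreenbergLNM1716, §1 (p. 60)] -/
theorem SharpFlatColemanKatoDataContra.isTorsion_of_nontrivial
    (C : SharpFlatColemanKatoDataContra W p f ϖ κ γ ι ap g c col I) [Nontrivial I.H]
    {Lsharp Lflat : IwasawaAlgebra p} (hL : IsSprungPair f p ap Lsharp Lflat)
    (hL0 : chromaticL col Lsharp Lflat ≠ 0) (Y' : W.FineSelmerDualData κ γ⁻¹)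
    (hY' : Module.IsTorsion (IwasawaAlgebra p) Y'.X) (D : SharpFlatSelmerDualData W κ γ ι ap g c col) :
    Module.IsTorsion (IwasawaAlgebra p) D.X := by
  obtain ⟨D'⟩ := nonempty_sharpFlatSelmerDualData_of_mul_eq_one (mul_inv_cancel γ) D
  exact (sharpFlatSelmerDualData_isTorsion_inv_iff D D').mpr
    (C.isTorsion_inv_of_nontrivial hL hL0 Y' hY' D')

/-- **Both colours at once** (the output shape of `thm714seq_sharpFlatColemanKato_zetaJoint_contra`): from a
♯-package `Cs` and a ♭-package `Cf` on the same pinned `I`, `𝐇¹ ≠ 0`, a torsion `γ⁻¹`-keyed fine dual datum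
and a Sprung pair with `L^• ≠ 0`: every `γ`-keyed dual datum of colour `•` is torsion (case split on `•`).
[cite: Sprung2012, Thm. 7.14 with (3) (p. 1504), Prop. 7.19 (p. 1505)] -/
theorem SharpFlatColemanKatoDataContra.isTorsion_of_nontrivial_of_pair
    (Cs : SharpFlatColemanKatoDataContra W p f ϖ κ γ ι ap g c Chroma.sharp I)
    (Cf : SharpFlatColemanKatoDataContra W p f ϖ κ γ ι ap g c Chroma.flat I) [Nontrivial I.H]
    {Lsharp Lflat : IwasawaAlgebra p} (hL : IsSprungPair f p ap Lsharp Lflat)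
    (hL0 : chromaticL col Lsharp Lflat ≠ 0) (Y' : W.FineSelmerDualData κ γ⁻¹)
    (hY' : Module.IsTorsion (IwasawaAlgebra p) Y'.X) (D : SharpFlatSelmerDualData W κ γ ι ap g c col) :
    Module.IsTorsion (IwasawaAlgebra p) D.X := by
  cases col with
  | sharp => exact Cs.isTorsion_of_nontrivial hL hL0 Y' hY' D
  | flat => exact Cf.isTorsion_of_nontrivial hL hL0 Y' hY' D

/-- **`𝐇¹_Γ ≠ 0` WITHOUT (12.2.2), at irreducible image** (token-for-token port of the sibling's
`SharpFlatColemanKatoData.nontrivial_of_normalised`; the field `image_zeta_localized` has the same text in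
both keyings): if `ρ̄_{E,p}` is irreducible and a Néron-normalised generator `G₁ ≠ 0` of colour `•` exists
(`ι G₁ = C(ϖ)·ι L^•`), then at the height-one prime `(T)` some `s ∉ (T)` has `s·G₁ ∈ colMap(Z)`; as `s·G₁ ≠ 0`,
`Z ⊂ 𝐇¹` has a non-zero element. [cite: Sprung2012, Def. 6.1 (p. 1495), Def. 7.12 (p. 1503), Thm. 7.14 (p. 1504)] -/
theorem SharpFlatColemanKatoDataContra.nontrivial_of_normalised
    (C : SharpFlatColemanKatoDataContra W p f ϖ κ γ ι ap g c col I) (hirr : W.HasIrreducibleModPGaloisRep p)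
    {Lsharp Lflat G₁ : IwasawaAlgebra p} (hL : IsSprungPair f p ap Lsharp Lflat)
    (hG₁ : iwasawaToPowerSeries p G₁ =
      PowerSeries.C ((ϖ : ℚ) : ℚ_[p]) * iwasawaToPowerSeries p (chromaticL col Lsharp Lflat))
    (hG0 : G₁ ≠ 0) : Nontrivial I.H := by
  obtain ⟨s, hs, hsG, -⟩ := C.image_zeta_localized hirr Lsharp Lflat G₁ hL hG₁
    (IwasawaAlgebra.primeT p) (IwasawaAlgebra.height_primeT p)
  obtain ⟨z, -, hz⟩ := Submodule.mem_map.mp hsG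
  have hs0 : s ≠ 0 := fun h ↦ hs (h ▸ Ideal.zero_mem _)
  have hz0 : z ≠ 0 := by
    rintro rfl
    rw [map_zero] at hz
    exact mul_ne_zero hs0 hG0 hz.symm
  exact nontrivial_of_ne z 0 hz0

/-- **Sprung Thm. 7.14 (torsion clause) WITHOUT (12.2.2), at irreducible image, print keying**: package `C`
of colour `•`, `ρ̄_{E,p}` irreducible, a Sprung pair with `L^• ≠ 0` and a Néron-normalised `G₁ ≠ 0`, a torsion
`γ⁻¹`-keyed fine dual datum `Y′` ⟹ every `γ`-keyed dual datum of `Sel^•(E/ℚ_∞)` is `Λ`-torsion.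
[cite: Sprung2012, Def. 6.1 (p. 1495), Thm. 7.14 with (3) (p. 1504)] -/
theorem SharpFlatColemanKatoDataContra.isTorsion_of_normalised
    (C : SharpFlatColemanKatoDataContra W p f ϖ κ γ ι ap g c col I) (hirr : W.HasIrreducibleModPGaloisRep p)
    {Lsharp Lflat G₁ : IwasawaAlgebra p} (hL : IsSprungPair f p ap Lsharp Lflat)
    (hL0 : chromaticL col Lsharp Lflat ≠ 0)
    (hG₁ : iwasawaToPowerSeries p G₁ =
      PowerSeries.C ((ϖ : ℚ) : ℚ_[p]) * iwasawaToPowerSeries p (chromaticL col Lsharp Lflat))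
    (hG0 : G₁ ≠ 0) (Y' : W.FineSelmerDualData κ γ⁻¹) (hY' : Module.IsTorsion (IwasawaAlgebra p) Y'.X)
    (D : SharpFlatSelmerDualData W κ γ ι ap g c col) :
    Module.IsTorsion (IwasawaAlgebra p) D.X := by
  haveI : Nontrivial I.H := C.nontrivial_of_normalised hirr hL hG₁ hG0
  exact C.isTorsion_of_nontrivial hL hL0 Y' hY' D

/-- A Néron-normalised generator of a NON-ZERO colour is non-zero as soon as `ϖ ≠ 0` (`ι : Λ → ℚ_p⟦T⟧` is
injective and `ℚ_p⟦T⟧` is a domain); private plumbing, as in the sibling. [folklore] -/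
private theorem normalised_ne_zero' {ϖ' : ℚ} (hϖ : ϖ' ≠ 0) {Lsharp Lflat G₁ : IwasawaAlgebra p}
    (hL0 : chromaticL col Lsharp Lflat ≠ 0)
    (hG₁ : iwasawaToPowerSeries p G₁ =
      PowerSeries.C ((ϖ' : ℚ) : ℚ_[p]) * iwasawaToPowerSeries p (chromaticL col Lsharp Lflat)) :
    G₁ ≠ 0 := by
  rintro rfl
  rw [map_zero, eq_comm, mul_eq_zero] at hG₁
  rcases hG₁ with h | h
  · have h' := congrArg PowerSeries.constantCoeff h
    simp only [PowerSeries.constantCoeff_C, map_zero] at h'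
    exact hϖ (by exact_mod_cast h')
  · exact hL0 (iwasawaToPowerSeries_injective p (by rw [h, map_zero]))

end PackageContra

/-- **Sprung 2012 Thm. 1.2 / 7.14 DERIVED from the three PRINT-KEYED / keying-immune named inputs.** The
named fact `thm714_sharpFlatSelmerDual_finite_torsion` follows from: `hCK` — the contragredient ♯/♭
Coleman–Kato package `thm714seq_sharpFlatColemanKato_zeta_contra` (Def. 6.1, Props. 7.3/7.6, (3) of Thm. 7.14
with Kato's Thm. 12.6 zeta submodule, duals over `γ⁻¹` against the covariant `𝐇¹` — the print keying);
`hH1` — Kato's (12.2.2) (`Kato2004.one_le_rank_iwasawaH1`); `hYt` — Kato's Thm. 12.4 (1) ∘ (17.13.1)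
(`Kato2004_fineSelmerDual_isTorsion`). It is `thm714_sharpFlatSelmerDual_finite_torsion_of_colMap_contra` fed
with the projections `colMap` / `colMap_injective` / `exact` of the package. An implication between named facts;
none of the three inputs is discharged here. This is the print-keyed replacement of the sibling's
`thm714_sharpFlatSelmerDual_finite_torsion_of_colemanKato` (whose package hypothesis is the `γ`-keyed one).
[cite: Sprung2012, Thm. 1.2 (p. 1486), Thm. 7.14 with (3) (p. 1504), Def. 6.1 (p. 1495)]
[cite: Kato2004Asterisque, §12.2 (12.2.2) (p. 220), Thm. 12.4 (1) (p. 221)] -/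
theorem thm714_sharpFlatSelmerDual_finite_torsion_of_colemanKatoContra
    (hCK : thm714seq_sharpFlatColemanKato_zeta_contra) (hH1 : Kato2004.one_le_rank_iwasawaH1)
    (hYt : Kato2004_fineSelmerDual_isTorsion) :
    thm714_sharpFlatSelmerDual_finite_torsion := by
  refine thm714_sharpFlatSelmerDual_finite_torsion_of_colMap_contra ?_ hH1 hYt
  intro W _ _ p _ _ _ _ N _ f ϖ κ γ hp hgood hss hf hϖ hκ hγ hγ' v hv g hg cneg c hH col I
  obtain ⟨C⟩ := hCK W p f ϖ κ γ hp hgood hss hf hϖ hκ hγ hγ' v hv g hg cneg c hH col I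
  exact ⟨C.colMap, C.colMap_injective, C.exact⟩

/-- **Thm. 7.14 from the JOINT print-keyed package** `thm714seq_sharpFlatColemanKato_zetaJoint_contra` + Kato
(12.2.2) + Kato Thm. 12.4 (1): by `thm714seq_sharpFlatColemanKato_zeta_contra_of_joint` and the previous theorem.
[cite: Sprung2012, Def. 7.12 (p. 1503), Thm. 7.14 with (3) (p. 1504), Prop. 7.19 (p. 1505)] -/
theorem thm714_sharpFlatSelmerDual_finite_torsion_of_zetaJointContra
    (hJ : thm714seq_sharpFlatColemanKato_zetaJoint_contra) (hH1 : Kato2004.one_le_rank_iwasawaH1)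
    (hYt : Kato2004_fineSelmerDual_isTorsion) :
    thm714_sharpFlatSelmerDual_finite_torsion :=
  thm714_sharpFlatSelmerDual_finite_torsion_of_colemanKatoContra
    (thm714seq_sharpFlatColemanKato_zeta_contra_of_joint hJ) hH1 hYt

/-- **Thm. 7.14 for ONE curve at irreducible image, from the print-keyed package and Kato's Thm. 12.4 (1)
alone** (the class-X8 shape: `p = 3`, `E[3]` irreducible, `|ϖ|₃ = 1`): in the binder telescope of the fact, if
moreover `ρ̄_{E,p}` is irreducible and the colour `•` (with `L^• ≠ 0`) admits a Néron-normalised generator `G₁`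
for a period ratio `ϖ ≠ 0` of `f` (`ι G₁ = C(ϖ)·ι L^•`), then every `γ`-keyed dual datum of `Sel^•(E/ℚ_∞)` is
finitely generated `Λ`-torsion — `𝐇¹ ≠ 0` from `Z ≠ 0` (`nontrivial_of_normalised`) instead of (12.2.2). Port of
the sibling's `sharpFlatSelmerDual_finite_torsion_of_colemanKato_of_irreducible` to the print keying.
[cite: Sprung2012, Thm. 1.2 (p. 1486), Def. 6.1 (p. 1495), Thm. 7.14 with (3) (p. 1504)]
[cite: Kato2004Asterisque, Thm. 12.4 (1) (p. 221)] -/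
theorem sharpFlatSelmerDual_finite_torsion_of_colemanKatoContra_of_irreducible
    (hCK : thm714seq_sharpFlatColemanKato_zeta_contra) (hYt : Kato2004_fineSelmerDual_isTorsion)
    (W : WeierstrassCurve ℚ) [W.IsElliptic] [W.IsGloballyMinimal] (p : ℕ) [Fact p.Prime]
    (hp : p ≠ 2) (hgood : W.HasGoodReductionAtPrime p) (hss : (p : ℤ) ∣ W.frobeniusTrace p)
    (hirr : W.HasIrreducibleModPGaloisRep p)
    {N : ℕ} [NeZero N] (f : CuspForm (Gamma0 N) 2) (hf : IsNewformOf W f) (ϖ : ℚ) (hϖ0 : ϖ ≠ 0)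
    (hϖ : (ϖ : ℝ) * W.realPeriodRat = plusPeriod f)
    (κ : ZpExtension ℚ p) (γ : absoluteGaloisGroup ℚ)
    (hκ : κ.IsCyclotomic) (hγ : κ.IsTopGenerator γ) (hγ' : IsCyclotomicVariable p γ)
    (v : HeightOneSpectrum (𝓞 ℚ)) (hv : (p : 𝓞 ℚ) ∈ v.asIdeal)
    (g : absoluteGaloisGroup (v.adicCompletion ℚ))
    (hg : κ.IsTopGenerator (resGalOfEmb (closureEmb (K := ℚ) (v.adicCompletion ℚ)) g))
    (cneg : localPoints W (v.adicCompletion ℚ)) (c : ℕ → localPoints W (v.adicCompletion ℚ))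
    (hH : IsHondaSystem κ (closureEmb (K := ℚ) (v.adicCompletion ℚ)) W (W.frobeniusTrace p) g cneg c)
    (col : Chroma) (Lsharp Lflat : IwasawaAlgebra p)
    (hL : IsSprungPair f p (W.frobeniusTrace p) Lsharp Lflat) (hL0 : chromaticL col Lsharp Lflat ≠ 0)
    (G₁ : IwasawaAlgebra p)
    (hG₁ : iwasawaToPowerSeries p G₁ =
      PowerSeries.C ((ϖ : ℚ) : ℚ_[p]) * iwasawaToPowerSeries p (chromaticL col Lsharp Lflat))
    (D : SharpFlatSelmerDualData W κ γ (closureEmb (K := ℚ) (v.adicCompletion ℚ))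
      (W.frobeniusTrace p) g c col) :
    Module.Finite (IwasawaAlgebra p) D.X ∧ Module.IsTorsion (IwasawaAlgebra p) D.X := by
  refine ⟨D.moduleFinite hγ, ?_⟩
  haveI : ContinuousSMul ℤ_[p] (W.tateModule p) := TateModule.continuousSMul_padicInt
  haveI : Module.Free ℤ_[p] (W.tateModule p) := W.module_free_tateModule_holds p
  haveI : Module.Finite ℤ_[p] (W.tateModule p) := W.module_finite_tateModule_holds p
  obtain ⟨I⟩ := Kato2004.nonempty_iwasawaH1Data_holds W p κ γ hκ hγ
  obtain ⟨C⟩ := hCK W p f ϖ κ γ hp hgood hss hf hϖ hκ hγ hγ' v hv g hg cneg c hH col I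
  obtain ⟨Y'⟩ := W.nonempty_fineSelmerDualData' κ γ⁻¹
  exact C.isTorsion_of_normalised hirr hL hL0 hG₁ (normalised_ne_zero' hϖ0 hL0 hG₁) Y'
    (fineSelmerDual_isTorsion_inv_of_kato2004 hYt W p hκ hγ Y') D

end Literature.NumberTheory.EllipticCurves.Sprung2012

end
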